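import Mathlib

/-!
# No conference matrix of order 334 has a core developed over ANY group of order 333 (kernel; index-3 fold)

Framing: lottery ticket; floor = certified bounds/negative ranges.  Cell pub-namedobj (venture DiscreteObjects),
target (H) = a Hadamard matrix of order `668`, hadamard gen 28; successor of gen 27's `ConferencePairSymmetric` §3
(`no_cyclicCore_conference334`: no CIRCULANT core, `decide` over `12⁴` cases of a 9-fold compression) and
`AbelianCore334` (`no_G333Core_conference334`: no core over `(ℤ/3)²×ℤ/37`, again by `decide`).

THE ROUTE (row F11″ of the census).  A conference matrix `C(334)` gives `H(668)` (gen 27 `ConferenceRoute668`);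
normalising its border, `C(334)` is a `333×333` core `S` (`0` diagonal, `±1` off it) with `S Sᵀ = 333·I − J`.
The core is *developed over a group* `G` of order `333` ('type 1', a Cayley / group matrix) when
`S_{g,h} = a(g⁻¹h)` for an array `a : G → {0, ±1}`; in first-row terms: `a(1) = 0`, `a(g) = ±1 (g ≠ 1)` and the
two-level autocorrelation `Σ_u a(u) a(u t) = −1` for every `t ≠ 1` — equivalently a Paley-type partial difference
set `(333,166,82,83)` in `G`, i.e. a conference graph on `333` vertices that is a Cayley graph of `G`
(Seberry–Yamada 2020 §8.4: Paley-type PDS in `G` of order `v` ⇒ `C(v+1)` ⇒ `H(2v+2)`).  The groups of order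
`333 = 3²·37` are `ℤ/333`, `(ℤ/3)²×ℤ/37` and three nonabelian ones (`ℤ/37 ⋊ ℤ/9` twice, `(ℤ/37 ⋊ ℤ/3)×ℤ/3`).

THIS FILE excludes ALL of them at once, with a one-page argument and no case enumeration:
* §1 **`autocorr_perm_mod_four`**: `Σ_i x(i)x(σ i) ≡ |ι| (mod 4)` for a `±1` vector and ANY permutation `σ`
  (`∏_i x(i)x(σ i) = (∏ x)² = 1`, so the number of `−1` terms is even);
* §2 for a cored array with autocorrelation `−1`: **`core_inv_symm`** (`|G| ≡ 1 (mod 4)` ⇒ `a(t⁻¹) = a(t)`; fill the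
  zero and apply §1 to `u ↦ u t`), **`core_inv_skew`** (`|G| ≡ 3 (mod 4)` ⇒ `a(t⁻¹) = −a(t)`), **`core_rowsum_zero`**
  (`(Σa)² = Σ_t Σ_u a(u)a(ut) = 0`), and the **fold identity** **`fiber_sum_sq`**: for ANY subgroup `K`, the sums
  `F(q)` of `a` over the left cosets `q` of `K` satisfy `Σ_q F(q)² = Σ_{t ∈ K} Σ_u a(u)a(ut) = |G| − |K|`;
  `fiber_sum_inv(_skew)`: `F(q⁻¹) = ±F(q)` when `K` is normal;
* §3–§4 **`groupCore_index_three`** (the INDEX-3 CRITERION): if `K ⊴ G` has index `3`, then `G/K = {1, w, w⁻¹}`,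
  `F(1) + F(w) + F(w⁻¹) = 0`, and `F(1)² + F(w)² + F(w⁻¹)² = 2|G|/3`; with `F(w⁻¹) = F(w)` this reads `6F(w)² = 2|G|/3`,
  i.e. **`|G| = 9·F(w)²`** (`|G| ≡ 1 (mod 4)`), and with `F(w⁻¹) = −F(w)`, `F(1) = 0`: **`|G| = 3·F(w)²`** (`|G| ≡ 3 (mod 4)`);
* **`exists_normal_index_three_of_card_333`** (Sylow, Mathlib): every group of order `333` has a normal subgroup of
  index `3`; hence **`no_groupCore_conference334`**: `333 = 9·37` and `37` is not a square — NO conference matrix of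
  order `334` has a core developed over any group of order `333` (no Paley-type PDS / Cayley conference graph on any
  group of order `333`); **`no_addGroupCore_conference334`** is the additive spelling, of which gen 27's two theorems
  (`ℤ/333`, `(ℤ/3)²×ℤ/37`; hypothesis `PAF a s = Σ_i a(i)a(i+s) = −1`) are the abelian instances.

PRINT STATUS.  Abelian groups: classical (S. L. Ma 1984/1994 — an abelian regular PDS with non-square `Δ` lives in a
group of prime-power order `p^(2s+1)`; `333` is not a prime power).  The three nonabelian groups of order `333`: no
exclusion found in print (the nonabelian restrictions of Swartz–Tauscheck, JCD 2021 = arXiv:2006.00353, are for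
NON-conference parameters); the index-3 criterion and this kernel proof are ours — novelty PROVISIONAL.  `C(334)`,
`srg(333,166,82,83)` and `H(668)` themselves are OPEN and untouched.  Mathlib only; no `sorry`, no new definitions.
-/

namespace Summit.Ventures.DiscreteObjects.Hadamard

open Finset

/-! ## §1 Parity: `Σ_i x(i) x(σ i) ≡ |ι| (mod 4)` for a `±1` vector and ANY permutation `σ` -/

section parity
variable {ι : Type*} [Fintype ι] [DecidableEq ι]

omit [Fintype ι] in
/-- a product of `±1` values is `±1` -/
private lemma prod_pm_of_pm (s : Finset ι) (x : ι → ℤ) (hx : ∀ i, x i = 1 ∨ x i = -1) :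
    ∏ i ∈ s, x i = 1 ∨ ∏ i ∈ s, x i = -1 := by
  induction s using Finset.induction_on with
  | empty => simp
  | insert i s hi ih =>
    rw [Finset.prod_insert hi]
    rcases hx i with h | h <;> rcases ih with h' | h' <;> simp [h, h']

/-- **`Σ_i x(i)·x(σ i) ≡ |ι| (mod 4)`** for a `±1` vector `x` and any permutation `σ` of the index set: the number of
`i` with `x(i)x(σ i) = −1` is even because `∏_i x(i)x(σ i) = (∏ x)² = 1`. -/
theorem autocorr_perm_mod_four (σ : Equiv.Perm ι) (x : ι → ℤ) (hx : ∀ i, x i = 1 ∨ x i = -1) :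
    ∃ k : ℤ, ∑ i, x i * x (σ i) = Fintype.card ι - 4 * k := by
  set N := (univ.filter fun i : ι => x i * x (σ i) = -1).card with hN
  have hterm : ∀ i : ι, x i * x (σ i) = if x i * x (σ i) = -1 then -1 else 1 := by
    intro i
    split_ifs with h
    · exact h
    · rcases hx i with h1 | h1 <;> rcases hx (σ i) with h2 | h2 <;> simp_all
  have hsum : ∑ i, x i * x (σ i) = Fintype.card ι - 2 * N := by
    rw [Finset.sum_congr rfl fun i _ => hterm i, Finset.sum_ite, Finset.sum_const, Finset.sum_const, smul_neg,
      nsmul_eq_mul, nsmul_eq_mul, mul_one, ← hN]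
    have hsplit := Finset.card_filter_add_card_filter_not (s := (univ : Finset ι)) (fun i => x i * x (σ i) = -1)
    rw [Finset.card_univ, ← hN] at hsplit
    have h2 : ((univ.filter fun i : ι => ¬ x i * x (σ i) = -1).card : ℤ) = Fintype.card ι - N := by
      have : (N : ℤ) + (univ.filter fun i : ι => ¬ x i * x (σ i) = -1).card = Fintype.card ι := by
        exact_mod_cast hsplit
      linarith
    rw [h2]; ring
  have hprod : ∏ i, (x i * x (σ i)) = 1 := by
    rw [Finset.prod_mul_distrib, Fintype.prod_equiv σ (fun i => x (σ i)) x (fun _ => rfl), ← sq]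
    rcases prod_pm_of_pm univ x hx with h | h <;> rw [h] <;> norm_num
  have hprod' : ∏ i, (x i * x (σ i)) = (-1) ^ N := by
    rw [Finset.prod_congr rfl fun i _ => hterm i, Finset.prod_ite, Finset.prod_const, Finset.prod_const, one_pow,
      mul_one, ← hN]
  rw [hprod'] at hprod
  have hev : Even N := (neg_one_pow_eq_one_iff_even (by norm_num)).mp hprod
  obtain ⟨k, hk⟩ := hev
  exact ⟨k, by rw [hsum, hk]; push_cast; ring⟩

end parity

/-! ## §2 Cored `±1` arrays on a finite group with two-level autocorrelation `−1` -/

section group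
variable {G : Type*} [Group G] [Fintype G] [DecidableEq G]

/-- Filling the zero at `1` of a cored array: for `t ≠ 1`,
`Σ_u ā(u) ā(u t) = Σ_u a(u) a(u t) + a(t) + a(t⁻¹)`, where `ā(1) = 1` and `ā = a` elsewhere. -/
theorem fill_autocorr (a : G → ℤ) (ha1 : a 1 = 0) {t : G} (ht : t ≠ 1) :
    ∑ u, (if u = 1 then 1 else a u) * (if u * t = 1 then 1 else a (u * t)) =
      ∑ u, a u * a (u * t) + (a t + a t⁻¹) := by
  have hne : (1 : G) ≠ t⁻¹ := fun h => ht (inv_eq_one.mp h.symm)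
  have key : ∀ u, (if u = 1 then 1 else a u) * (if u * t = 1 then 1 else a (u * t)) =
      a u * a (u * t) + (if u = 1 then a t else if u = t⁻¹ then a t⁻¹ else 0) := by
    intro u
    by_cases hu : u = 1
    · subst hu; simp [ht, ha1]
    · by_cases hut : u = t⁻¹
      · subst hut; simp [ha1, hne.symm]
      · have : u * t ≠ 1 := fun h => hut (eq_inv_of_mul_eq_one_left h)
        simp [hu, hut, this]
  have hd : ∑ u, (if u = 1 then a t else if u = t⁻¹ then a t⁻¹ else 0) = a t + a t⁻¹ := by
    rw [Fintype.sum_eq_add (f := fun u => if u = 1 then a t else if u = t⁻¹ then a t⁻¹ else 0) 1 t⁻¹ hne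
      (by rintro u ⟨hu1, hut⟩; simp [hu1, hut])]
    simp [hne.symm]
  rw [Finset.sum_congr rfl fun u _ => key u, Finset.sum_add_distrib, hd]

/-- `Σ_u a(u)² = |G| − 1` for a cored `±1` array. -/
theorem core_autocorr_one (a : G → ℤ) (ha1 : a 1 = 0) (ha : ∀ g, g ≠ 1 → a g = 1 ∨ a g = -1) :
    ∑ u, a u * a u = Fintype.card G - 1 := by
  have : ∀ u, a u * a u = 1 - if u = 1 then 1 else 0 := by
    intro u; by_cases hu : u = 1
    · simp [hu, ha1]
    · rcases ha u hu with h | h <;> simp [hu, h]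
  rw [Finset.sum_congr rfl fun u _ => this u, Finset.sum_sub_distrib, Finset.sum_ite_eq' univ (1 : G)]
  simp

/-- **Parity-forced symmetry.**  If `|G| ≡ 1 (mod 4)`, a cored `±1` array `a` (`a(1) = 0`) with
`Σ_u a(u)a(ut) = −1` for all `t ≠ 1` is inverse-symmetric: `a(t⁻¹) = a(t)`. -/
theorem core_inv_symm (hG : Fintype.card G % 4 = 1) (a : G → ℤ) (ha1 : a 1 = 0)
    (ha : ∀ g, g ≠ 1 → a g = 1 ∨ a g = -1) (hC : ∀ t, t ≠ 1 → ∑ u, a u * a (u * t) = -1) (t : G) :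
    a t⁻¹ = a t := by
  by_cases ht : t = 1
  · simp [ht]
  have hfill : ∀ u, (if u = 1 then (1:ℤ) else a u) = 1 ∨ (if u = 1 then (1:ℤ) else a u) = -1 := by
    intro u; by_cases hu : u = 1
    · simp [hu]
    · simpa [hu] using ha u hu
  obtain ⟨k, hk⟩ := autocorr_perm_mod_four (Equiv.mulRight t) (fun u => if u = 1 then 1 else a u) hfill
  simp only [Equiv.coe_mulRight] at hk
  rw [fill_autocorr a ha1 ht, hC t ht] at hk
  obtain ⟨m, hm⟩ : ∃ m : ℕ, Fintype.card G = 4 * m + 1 := ⟨Fintype.card G / 4, by omega⟩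
  rw [hm] at hk; push_cast at hk
  rcases ha t ht with h1 | h1 <;> rcases ha t⁻¹ (inv_ne_one.mpr ht) with h2 | h2 <;>
    simp only [h1, h2] at hk ⊢ <;> omega

/-- **Parity-forced skew symmetry.**  If `|G| ≡ 3 (mod 4)`, the same hypotheses force `a(t⁻¹) = −a(t)`. -/
theorem core_inv_skew (hG : Fintype.card G % 4 = 3) (a : G → ℤ) (ha1 : a 1 = 0)
    (ha : ∀ g, g ≠ 1 → a g = 1 ∨ a g = -1) (hC : ∀ t, t ≠ 1 → ∑ u, a u * a (u * t) = -1) (t : G) :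
    a t⁻¹ = - a t := by
  by_cases ht : t = 1
  · simp [ht, ha1]
  have hfill : ∀ u, (if u = 1 then (1:ℤ) else a u) = 1 ∨ (if u = 1 then (1:ℤ) else a u) = -1 := by
    intro u; by_cases hu : u = 1
    · simp [hu]
    · simpa [hu] using ha u hu
  obtain ⟨k, hk⟩ := autocorr_perm_mod_four (Equiv.mulRight t) (fun u => if u = 1 then 1 else a u) hfill
  simp only [Equiv.coe_mulRight] at hk
  rw [fill_autocorr a ha1 ht, hC t ht] at hk
  obtain ⟨m, hm⟩ : ∃ m : ℕ, Fintype.card G = 4 * m + 3 := ⟨Fintype.card G / 4, by omega⟩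
  rw [hm] at hk; push_cast at hk
  rcases ha t ht with h1 | h1 <;> rcases ha t⁻¹ (inv_ne_one.mpr ht) with h2 | h2 <;>
    simp only [h1, h2] at hk ⊢ <;> omega

/-- **Row sum.** `(Σ a)² = Σ_t Σ_u a(u)a(ut) = (|G| − 1) − (|G| − 1) = 0`, so `Σ_u a(u) = 0`. -/
theorem core_rowsum_zero (a : G → ℤ) (ha1 : a 1 = 0) (ha : ∀ g, g ≠ 1 → a g = 1 ∨ a g = -1)
    (hC : ∀ t, t ≠ 1 → ∑ u, a u * a (u * t) = -1) : ∑ u, a u = 0 := by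
  have hsq : (∑ u, a u) * (∑ u, a u) = ∑ t, ∑ u, a u * a (u * t) := by
    rw [Finset.sum_mul_sum,
      show (∑ u, ∑ v, a u * a v) = ∑ u, ∑ t, a u * a (u * t) from
        Finset.sum_congr rfl fun u _ =>
          (Fintype.sum_equiv (Equiv.mulLeft u) (fun t => a u * a (u * t)) (fun v => a u * a v)
            fun t => by simp).symm]
    exact Finset.sum_comm
  have hCt : ∀ t, ∑ u, a u * a (u * t) = (if t = 1 then (Fintype.card G : ℤ) else 0) - 1 := by
    intro t; by_cases ht : t = 1
    · simp only [ht, mul_one, if_true]; exact core_autocorr_one a ha1 ha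
    · rw [hC t ht]; simp [ht]
  rw [Finset.sum_congr rfl fun t _ => hCt t, Finset.sum_sub_distrib, Finset.sum_ite_eq' univ (1 : G)] at hsq
  simp at hsq
  exact hsq

omit [DecidableEq G] in
/-- Fibre sums over the left cosets of a subgroup `K`: the fibre of `v` is `{v t : t ∈ K}`. -/
theorem fiber_sum_eq (a : G → ℤ) (K : Subgroup G) [DecidablePred (· ∈ K)] [DecidableEq (G ⧸ K)] (v : G) :
    ∑ u : G, (if (u : G ⧸ K) = (v : G ⧸ K) then a u else 0) = ∑ t ∈ univ.filter (· ∈ K), a (v * t) := by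
  rw [Finset.sum_filter]
  refine (Fintype.sum_equiv (Equiv.mulLeft v) (fun t => if t ∈ K then a (v * t) else 0)
    (fun u : G => if (u : G ⧸ K) = (v : G ⧸ K) then a u else 0) fun t => ?_).symm
  have : ((v * t : G) : G ⧸ K) = (v : G ⧸ K) ↔ t ∈ K := by
    rw [QuotientGroup.eq, mul_inv_rev, inv_mul_cancel_right, K.inv_mem_iff]
  simp [this]

omit [DecidableEq G] in
/-- **Fold identity.** For any subgroup `K`, with `F(q) = Σ_{u ∈ q} a(u)` the sums of `a` over the left cosets:
`Σ_q F(q)² = Σ_{t ∈ K} Σ_u a(u) a(u t)`. -/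
theorem fiber_sum_sq (a : G → ℤ) (K : Subgroup G) [DecidablePred (· ∈ K)] [Fintype (G ⧸ K)]
    [DecidableEq (G ⧸ K)] :
    ∑ q : G ⧸ K, (∑ u : G, if (u : G ⧸ K) = q then a u else 0) ^ 2 =
      ∑ t ∈ univ.filter (· ∈ K), ∑ u, a u * a (u * t) := by
  calc ∑ q : G ⧸ K, (∑ u : G, if (u : G ⧸ K) = q then a u else 0) ^ 2
      = ∑ q : G ⧸ K, ∑ v : G, (if (v : G ⧸ K) = q then a v else 0) *
          (∑ u : G, if (u : G ⧸ K) = q then a u else 0) := by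
        refine Finset.sum_congr rfl fun q _ => ?_
        rw [sq, Finset.sum_mul]
    _ = ∑ v : G, ∑ q : G ⧸ K, (if (v : G ⧸ K) = q then a v else 0) *
          (∑ u : G, if (u : G ⧸ K) = q then a u else 0) := Finset.sum_comm
    _ = ∑ v, a v * ∑ u : G, (if (u : G ⧸ K) = (v : G ⧸ K) then a u else 0) := by
        refine Finset.sum_congr rfl fun v _ => ?_
        simp_rw [ite_mul, zero_mul]
        rw [Finset.sum_ite_eq]
        simp
    _ = ∑ v, a v * ∑ t ∈ univ.filter (· ∈ K), a (v * t) := by simp_rw [fiber_sum_eq]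
    _ = ∑ t ∈ univ.filter (· ∈ K), ∑ u, a u * a (u * t) := by
        simp_rw [Finset.mul_sum]
        exact Finset.sum_comm

omit [DecidableEq G] in
/-- The fibre sums of an inverse-symmetric array over the cosets of a NORMAL subgroup are inverse-symmetric. -/
theorem fiber_sum_inv (a : G → ℤ) (hsym : ∀ t, a t⁻¹ = a t) (K : Subgroup G) [K.Normal]
    [DecidableEq (G ⧸ K)] (q : G ⧸ K) :
    ∑ u : G, (if (u : G ⧸ K) = q⁻¹ then a u else 0) = ∑ u : G, (if (u : G ⧸ K) = q then a u else 0) := by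
  refine Fintype.sum_equiv (Equiv.inv G) _ _ fun u => ?_
  simp only [Equiv.inv_apply, hsym u, QuotientGroup.mk_inv, inv_eq_iff_eq_inv]

omit [DecidableEq G] in
/-- … and anti-symmetric for an inverse-skew array. -/
theorem fiber_sum_inv_skew (a : G → ℤ) (hskew : ∀ t, a t⁻¹ = - a t) (K : Subgroup G) [K.Normal]
    [DecidableEq (G ⧸ K)] (q : G ⧸ K) :
    ∑ u : G, (if (u : G ⧸ K) = q⁻¹ then a u else 0) = - ∑ u : G, (if (u : G ⧸ K) = q then a u else 0) := by
  rw [← Finset.sum_neg_distrib]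
  refine Fintype.sum_equiv (Equiv.inv G) _ _ fun u => ?_
  simp only [Equiv.inv_apply, hskew u, QuotientGroup.mk_inv, inv_eq_iff_eq_inv]
  split_ifs <;> simp

end group

/-! ## §3 Groups of order `3`: three-term sums -/

section three
variable {Q : Type*} [Group Q] [Fintype Q] [DecidableEq Q]

/-- In a group of order `3` pick `w ≠ 1`; then `Q = {1, w, w⁻¹}` with three distinct elements, so every sum over
`Q` is a three-term sum. -/
theorem exists_sum_three (hQ : Fintype.card Q = 3) :
    ∃ w : Q, w ≠ 1 ∧ w⁻¹ ≠ w ∧ ∀ f : Q → ℤ, ∑ q, f q = f 1 + f w + f w⁻¹ := by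
  obtain ⟨w, hw⟩ := Fintype.exists_ne_of_one_lt_card (by rw [hQ]; norm_num) (1 : Q)
  have hw' : w⁻¹ ≠ 1 := inv_ne_one.mpr hw
  have hww : w⁻¹ ≠ w := by
    intro h
    have h2 : orderOf w ∣ 2 := orderOf_dvd_of_pow_eq_one (by
      rw [pow_two]; nth_rewrite 1 [← h]; exact inv_mul_cancel w)
    have h3 : orderOf w ∣ 3 := hQ ▸ orderOf_dvd_card
    have h1 : orderOf w ∣ Nat.gcd 2 3 := Nat.dvd_gcd h2 h3
    norm_num at h1
    exact hw h1
  refine ⟨w, hw, hww, fun f => ?_⟩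
  have hs : ({1, w, w⁻¹} : Finset Q) = univ := by
    apply Finset.eq_univ_of_card
    rw [Finset.card_insert_of_notMem (by simp [hw.symm, hw'.symm]), Finset.card_pair hww.symm, hQ]
  rw [← hs, Finset.sum_insert (by simp [hw.symm, hw'.symm]), Finset.sum_pair hww.symm]
  ring

end three

/-! ## §4 The index-3 criterion and the groups of order `333` -/

section criterion
variable {G : Type*} [Group G] [Fintype G] [DecidableEq G]

/-- **Index-3 criterion.**  Let `a` be a cored `±1` array on a finite group `G` with `Σ_u a(u)a(ut) = −1` for all
`t ≠ 1`, and let `K ⊴ G` have index `3`.  Then `|G| = 9 f²` for an integer `f` if `|G| ≡ 1 (mod 4)`, and `|G| = 3 f²`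
if `|G| ≡ 3 (mod 4)` (`f` = the sum of `a` over a non-trivial coset of `K`). -/
theorem groupCore_index_three (K : Subgroup G) [K.Normal] (hK : K.index = 3) (a : G → ℤ) (ha1 : a 1 = 0)
    (ha : ∀ g, g ≠ 1 → a g = 1 ∨ a g = -1) (hC : ∀ t, t ≠ 1 → ∑ u, a u * a (u * t) = -1) :
    (Fintype.card G % 4 = 1 → ∃ f : ℤ, (Fintype.card G : ℤ) = 9 * f ^ 2) ∧
    (Fintype.card G % 4 = 3 → ∃ f : ℤ, (Fintype.card G : ℤ) = 3 * f ^ 2) := by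
  classical
  set F : G ⧸ K → ℤ := fun q => ∑ u : G, if (u : G ⧸ K) = q then a u else 0 with hF
  -- |K|
  have hKcard : ((univ.filter (· ∈ K)).card : ℤ) * 3 = Fintype.card G := by
    have h := K.index_mul_card
    rw [hK, Nat.card_eq_fintype_card, Nat.card_eq_fintype_card, Fintype.card_subtype] at h
    push_cast [← h]; ring
  -- Σ F² = |G| − |K|
  have hsq : ∑ q, F q ^ 2 = Fintype.card G - ((univ.filter (· ∈ K)).card : ℤ) := by
    rw [hF, fiber_sum_sq a K]
    have hCt : ∀ t, ∑ u, a u * a (u * t) = (if t = 1 then (Fintype.card G : ℤ) else 0) - 1 := by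
      intro t; by_cases ht : t = 1
      · simp only [ht, mul_one, if_true]; exact core_autocorr_one a ha1 ha
      · rw [hC t ht]; simp [ht]
    rw [Finset.sum_congr rfl fun t _ => hCt t, Finset.sum_sub_distrib, Finset.sum_ite_eq']
    simp [K.one_mem]
  -- Σ F = 0
  have hsum : ∑ q, F q = 0 := by
    rw [hF, Finset.sum_comm]
    simp only [Finset.sum_ite_eq, Finset.mem_univ, if_true]
    exact core_rowsum_zero a ha1 ha hC
  -- the quotient has order 3
  have hQ : Fintype.card (G ⧸ K) = 3 := by
    rw [← Nat.card_eq_fintype_card, ← Subgroup.index_eq_card, hK]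
  obtain ⟨w, hw, hww, hthree⟩ := exists_sum_three hQ
  rw [hthree] at hsq hsum
  constructor
  · intro hG
    have hsym := core_inv_symm hG a ha1 ha hC
    have h1 : F w⁻¹ = F w := fiber_sum_inv a hsym K w
    refine ⟨F w, ?_⟩
    rw [h1] at hsq hsum
    have hF1 : F 1 ^ 2 = 4 * F w ^ 2 := by rw [show F 1 = -(2 * F w) by linarith]; ring
    linarith [hsq, hsum, hKcard, hF1]
  · intro hG
    have hskew := core_inv_skew hG a ha1 ha hC
    have h1 : F w⁻¹ = - F w := fiber_sum_inv_skew a hskew K w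
    have h0 : F 1 = 0 := by
      have := fiber_sum_inv_skew a hskew K 1
      rw [inv_one] at this
      linarith
    refine ⟨F w, ?_⟩
    rw [h1, h0] at hsq
    have h2 : (0 : ℤ) ^ 2 + F w ^ 2 + (-F w) ^ 2 = 2 * F w ^ 2 := by ring
    linarith [hsq, hKcard, h2]

/-- Every group of order `333 = 3²·37` has a normal subgroup of index `3` (Sylow: the Sylow `37`-subgroup `P` is
normal with quotient of order `9`; pull back a subgroup of order `3` of `G ⧸ P`; index `3 = minFac 333` ⇒ normal). -/
theorem exists_normal_index_three_of_card_333 {G : Type*} [Group G] [Finite G] (hG : Nat.card G = 333) :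
    ∃ K : Subgroup G, K.Normal ∧ K.index = 3 := by
  haveI : Fact (Nat.Prime 37) := ⟨by norm_num⟩
  haveI : Fact (Nat.Prime 3) := ⟨by norm_num⟩
  obtain ⟨P⟩ := (inferInstance : Nonempty (Sylow 37 G))
  have hP : Nat.card P = 37 := by
    obtain ⟨k, hk⟩ := IsPGroup.iff_card.mp P.isPGroup'
    have h1 : 37 ∣ Nat.card P := P.dvd_card_of_dvd_card (by rw [hG]; norm_num)
    have h2 : Nat.card P ∣ 333 := hG ▸ (P : Subgroup G).card_subgroup_dvd_card
    rw [hk] at h1 h2 ⊢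
    rcases k with _ | _ | k
    · norm_num at h1
    · norm_num
    · exfalso
      have : 37 ^ 2 ∣ 333 := dvd_trans (pow_dvd_pow 37 (by omega)) h2
      norm_num at this
  have hPi : (P : Subgroup G).index = 9 := by
    have h := (P : Subgroup G).index_mul_card
    rw [hP, hG] at h
    omega
  have h1 : Nat.card (Sylow 37 G) = 1 := by
    have hdvd : Nat.card (Sylow 37 G) ∣ 9 := hPi ▸ P.card_dvd_index
    have hmod : Nat.card (Sylow 37 G) % 37 = 1 := card_sylow_modEq_one 37 G
    have hle : Nat.card (Sylow 37 G) ≤ 9 := Nat.le_of_dvd (by norm_num) hdvd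
    interval_cases (Nat.card (Sylow 37 G)) <;> omega
  haveI : Subsingleton (Sylow 37 G) := (Nat.card_eq_one_iff_unique.mp h1).1
  haveI hPn : (P : Subgroup G).Normal := P.normal_of_subsingleton
  have hQ : Nat.card (G ⧸ (P : Subgroup G)) = 9 := by rw [← Subgroup.index_eq_card]; exact hPi
  obtain ⟨x, hx⟩ := exists_prime_orderOf_dvd_card' (G := G ⧸ (P : Subgroup G)) 3 (by rw [hQ]; norm_num)
  have hHc : Nat.card (Subgroup.zpowers x) = 3 := by rw [Nat.card_zpowers, hx]
  have hHi : (Subgroup.zpowers x).index = 3 := by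
    have h := (Subgroup.zpowers x).index_mul_card
    rw [hHc, hQ] at h
    omega
  have hidx : ((Subgroup.zpowers x).comap (QuotientGroup.mk' (P : Subgroup G))).index = 3 := by
    rw [Subgroup.index_comap_of_surjective _ (QuotientGroup.mk'_surjective _), hHi]
  refine ⟨(Subgroup.zpowers x).comap (QuotientGroup.mk' (P : Subgroup G)), ?_, hidx⟩
  exact Subgroup.normal_of_index_eq_minFac_card (by rw [hidx, hG]; norm_num)

/-- **No conference matrix of order `334` has a core developed over any group of order `333`.**
In first-row terms: there is no array `a : G → ℤ` on a group `G` of order `333` with `a(1) = 0`, `a(g) = ±1`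
(`g ≠ 1`) and `Σ_u a(u) a(u t) = −1` for all `t ≠ 1`.  (`333 ≡ 1 (mod 4)` and `333 = 9·37`, `37` not a square.) -/
theorem no_groupCore_conference334 (hG : Fintype.card G = 333) (a : G → ℤ) (ha1 : a 1 = 0)
    (ha : ∀ g, g ≠ 1 → a g = 1 ∨ a g = -1) (hC : ∀ t, t ≠ 1 → ∑ u, a u * a (u * t) = -1) : False := by
  obtain ⟨K, hKn, hK⟩ := exists_normal_index_three_of_card_333 (G := G) (by rw [Nat.card_eq_fintype_card, hG])
  obtain ⟨f, hf⟩ := (groupCore_index_three K hK a ha1 ha hC).1 (by rw [hG])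
  rw [hG] at hf
  push_cast at hf
  have hf2 : f ^ 2 = 37 := by linarith
  have hb : -7 < f ∧ f < 7 := by constructor <;> nlinarith
  obtain ⟨h1, h2⟩ := hb
  interval_cases f <;> omega

/-- **Additive spelling** (for `A = ℤ/333` and `A = (ℤ/3)²×ℤ/37` this is gen 27's `no_cyclicCore_conference334` /
`no_G333Core_conference334`, whose hypothesis `PAF a s = Σ_i a(i)a(i+s) = −1 (s ≠ 0)` is literally `hC`): no cored
`±1` array with two-level autocorrelation `−1` on ANY additive group of order `333`. -/
theorem no_addGroupCore_conference334 {A : Type*} [AddGroup A] [Fintype A] [DecidableEq A]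
    (hA : Fintype.card A = 333) (a : A → ℤ) (ha0 : a 0 = 0) (ha : ∀ g, g ≠ 0 → a g = 1 ∨ a g = -1)
    (hC : ∀ t, t ≠ 0 → ∑ u, a u * a (u + t) = -1) : False :=
  no_groupCore_conference334 (G := Multiplicative A) (by simpa using hA) (fun u => a (Multiplicative.toAdd u))
    (by simpa using ha0) (fun g hg => ha (Multiplicative.toAdd g) (by simpa using hg))
    (fun t ht => by
      rw [← hC (Multiplicative.toAdd t) (by simpa using ht)]
      exact Fintype.sum_equiv Multiplicative.toAdd _ _ fun u => by simp [toAdd_mul])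

end criterion

end Summit.Ventures.DiscreteObjects.Hadamard
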